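import Literature.IUT.LogVolume.Corollary22ThetaFieldExists
import HarnessLib

/-!
# The THETA CLOSURE FIELD `F‡ = F_tpd(√−1, √λ, √(λ−1), E_λ[3·5])` of a point of the `λ`-line

Mochizuki, *Inter-universal Teichmüller theory IV*, RIMS manuscript (Apr. 2020; = PRIMS **57** (2021)),
Thm. 1.10, p. 22: "`F = F_mod(√−1, E_{F_mod}[2·3·5]) := F_tpd(√−1, E_{F_tpd}[3·5])` — i.e., `F` is obtained
from `F_tpd` by adjoining `√−1`, together with the fields of definition of the `(3·5)`-torsion points of a model
`E_{F_tpd}` of the elliptic curve `E_F ×_F F̄` over `F_tpd` determined by the Legendre form"; [IUTchI]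
Def. 3.1 (b): "`F` is Galois over `F_mod`"; [IUTchIV] Thm. 1.10, Step (iii) (D0), p. 26: "`K/F_tpd` is unramified
over `v`" at the good places `v ∤ 2·3·5·l`.

The cell's findings F-L5t7-1 / F-L5t7-2 (= F-c312-8-g3-1), ruled by abc-iut-plan 2026-08-26T02:59:03Z: the
printed field `F_tpd(√−1, E_λ[15])` need NOT be Galois over `F_mod` (λ = −2−√3), and NO model of `E_λ` over
`F_mod` repairs this without breaking (D0) (the `F_mod`-models are additive quadratic twists of `E_λ` at good
places; λ = 3, `p = 7`). The consistent field is the GALOIS CLOSURE of the printed one over `F_mod`: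

  `F‡ := F_tpd(√−1, √λ, √(λ−1), E_λ[3·5]) ⊆ F̄_tpd`,

still generated over `F_tpd` by square roots of units-at-good-places and torsion coordinates of the
good-reduction Legendre curve (so (D0) survives), and stable under `Gal(F̄/F_mod)` (the conjugates of `λ` are
its six cross-ratio transforms, `E_{1−λ} ≅ E_λ^{(−1)}`, `E_{1/λ} ≅ E_λ^{(λ)}`; sequel file). THIS FILE (definition
lane) constructs `F‡` and proves its `F_tpd`-level properties:

* `thetaClosureGens P`, `thetaClosureField P` — the finite `Gal(F̄/F_tpd)`-stable generating set and the field;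
* `isGalois_thetaClosureField : IsGalois P.F F‡`; `finrank_thetaClosureField_dvd : [F‡ : F_tpd] ∣ 2²·46080`
  (`= 2¹²·3²·5`, Krull index of `ker ρ̄₃ ∩ ker ρ̄₅ ∩` the three quadratic fixers), hence prime to every prime
  `l ≥ 7`;
* `sqrt_mem_thetaClosureField`, `coords_mem_thetaClosureField` — the generators lie in `F‡`;
* `torsion_three_fixed` / `torsion_five_fixed` / `torsion_fifteen_fixed` — over the algebraic closure OF `F‡`
  the `3`-, `5`-, `15`-torsion of `E_λ ⊗ F‡` is `Gal`-fixed (the tree's cross-closure transport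
  `EllPoint.forall_smul_geomTorsion_map_eq_of_fixingSubgroup_le`); `isSemistable_thetaCurve_thetaClosureField`;
* `isThetaField_thetaClosureField` is NOT claimed (`F‡` is bigger than the printed field: its `adjoin_eq_top`
  clause needs the two extra square roots — see `Cor22.IsSubThetaField`, abc-iut-w4-d037, for the datum's clause).

Classical (Galois theory of torsion fields); TAKES NO SIDE on [IUTchIII] Cor. 3.12. The IUT quotations carry
[claim: Mochizuki2012, status: disputed]; everything else is proved.
-/

noncomputable section

open scoped Classical

namespace Literature.IUT.LogVolume

namespace Cor22

open NumberField IsDedekindDomain Literature.NumberTheory.DiophantineGeometry.GenEll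
open Literature.NumberTheory.EllipticCurves WeierstrassCurve IntermediateField Field

variable (P : NFPoint)

/-! ## Generic: the square roots of an element of the base form a finite `Gal`-stable set -/

section Sqrt

variable {K : Type} [Field K]

/-- The square roots in `K̄` of (the image of) `a ∈ K` form a finite set (roots of `X² − a`).
[cite: MilneFT2022, Ch. 5 (Kummer theory: the polynomial X² − a)] -/
theorem sqrtSet_finite (a : K) :
    {z : AlgebraicClosure K | z ^ 2 = algebraMap K _ a}.Finite := by
  refine ((Polynomial.X ^ 2 - Polynomial.C (algebraMap K (AlgebraicClosure K) a)).rootSet_finite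
    (AlgebraicClosure K)).subset fun z hz => ?_
  rw [Set.mem_setOf_eq] at hz
  rw [Polynomial.mem_rootSet]
  refine ⟨Polynomial.X_pow_sub_C_ne_zero two_pos _, ?_⟩
  simp [hz]

/-- `Gal(K̄/K)` permutes the square roots of `a ∈ K`. [cite: MilneFT2022, Ch. 5 (Kummer theory: the polynomial X² − a)] -/
theorem sq_eq_of_sq_eq (σ : AlgebraicClosure K ≃ₐ[K] AlgebraicClosure K) {a : K}
    {z : AlgebraicClosure K} (hz : z ^ 2 = algebraMap K _ a) : (σ z) ^ 2 = algebraMap K _ a := by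
  rw [← map_pow, hz, AlgEquiv.commutes]

/-- If `σ` fixes one square root `w` of `a ∈ K` it fixes every square root of `a` (they are `±w`).
[cite: MilneFT2022, Ch. 5 (Kummer theory: the polynomial X² − a)] -/
theorem eq_of_sq_eq_of_fix (σ : AlgebraicClosure K ≃ₐ[K] AlgebraicClosure K) {a : K}
    {w z : AlgebraicClosure K} (hw : w ^ 2 = algebraMap K _ a) (hσw : σ w = w)
    (hz : z ^ 2 = algebraMap K _ a) : σ z = z := by
  have h : z ^ 2 = w ^ 2 := by rw [hz, hw]
  rcases sq_eq_sq_iff_eq_or_eq_neg.1 h with rfl | rfl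
  · exact hσw
  · rw [map_neg, hσw]

/-- `[K(w) : K] ∣ 2` for `w ∈ K̄` with `w² ∈ K`. [cite: MilneFT2022, Ch. 5 (Kummer theory: the polynomial X² − a)] -/
theorem index_fixingSubgroup_adjoin_dvd_two [NumberField K] {a : K} {w : AlgebraicClosure K}
    (hw : w ^ 2 = algebraMap K _ a) :
    (adjoin K ({w} : Set (AlgebraicClosure K))).fixingSubgroup.index ∣ 2 := by
  rw [← IntermediateField.finrank_eq_fixingSubgroup_index]
  have hint : IsIntegral K w := Algebra.IsIntegral.isIntegral w
  rw [adjoin.finrank hint]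
  have hroot : Polynomial.aeval w (Polynomial.X ^ 2 - Polynomial.C a : Polynomial K) = 0 := by
    simp [hw]
  have hdvd : minpoly K w ∣ Polynomial.X ^ 2 - Polynomial.C a := minpoly.dvd K w hroot
  have hne : (Polynomial.X ^ 2 - Polynomial.C a : Polynomial K) ≠ 0 := Polynomial.X_pow_sub_C_ne_zero two_pos a
  have hdeg := Polynomial.natDegree_le_of_dvd hdvd hne
  rw [Polynomial.natDegree_X_pow_sub_C] at hdeg
  have hpos : 0 < (minpoly K w).natDegree := minpoly.natDegree_pos hint
  interval_cases (minpoly K w).natDegree <;> norm_num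

/-- `K(all square roots of a) = K(w)` for any one square root `w` (the other is `−w`).
[cite: MilneFT2022, Ch. 5 (Kummer theory: the polynomial X² − a)] -/
theorem adjoin_sqrtSet_eq {a : K} {w : AlgebraicClosure K} (hw : w ^ 2 = algebraMap K _ a) :
    adjoin K {z : AlgebraicClosure K | z ^ 2 = algebraMap K _ a} = adjoin K ({w} : Set (AlgebraicClosure K)) := by
  refine le_antisymm ?_ (adjoin.mono _ _ _ (by simpa using hw))
  refine adjoin_le_iff.mpr fun z hz => ?_
  rw [Set.mem_setOf_eq] at hz
  have h : z ^ 2 = w ^ 2 := by rw [hz, hw]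
  rcases sq_eq_sq_iff_eq_or_eq_neg.1 h with rfl | rfl
  · exact subset_adjoin K _ rfl
  · exact neg_mem (subset_adjoin K _ rfl)

/-- `K(√a)/K` is Galois (both square roots adjoined; characteristic zero). [cite: MilneFT2022, Ch. 3 (Galois extensions: splitting fields of separable polynomials)] -/
theorem isGalois_adjoin_sqrtSet [NumberField K] (a : K) :
    IsGalois K (adjoin K {z : AlgebraicClosure K | z ^ 2 = algebraMap K _ a}) :=
  isGalois_adjoin_of_stable fun σ _ hz => sq_eq_of_sq_eq σ hz

/-- `[K(√a) : K] ∣ 2`, as the index of the fixing group of `K(all square roots of a)`.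
[cite: MilneFT2022, Ch. 5 (Kummer theory: the polynomial X² − a)] -/
theorem index_fixingSubgroup_adjoin_sqrtSet_dvd_two [NumberField K] (a : K) :
    (adjoin K {z : AlgebraicClosure K | z ^ 2 = algebraMap K _ a}).fixingSubgroup.index ∣ 2 := by
  obtain ⟨w, hw⟩ : ∃ w : AlgebraicClosure K, w ^ 2 = algebraMap K _ a :=
    IsAlgClosed.exists_pow_nat_eq _ two_pos
  rw [adjoin_sqrtSet_eq hw]
  exact index_fixingSubgroup_adjoin_dvd_two hw

/-- The index of an intersection with a normal subgroup divides the product of the indices. [folklore] -/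
private theorem index_inf_dvd_mul_of_normal {G : Type*} [Group G] (A B : Subgroup G) [B.Normal] :
    (A ⊓ B).index ∣ A.index * B.index := by
  rw [inf_comm, ← Subgroup.relIndex_mul_index (inf_le_right : B ⊓ A ≤ A), Subgroup.inf_relIndex_right,
    mul_comm]
  exact Nat.mul_dvd_mul_left A.index (Subgroup.relIndex_dvd_index_of_normal B A)

end Sqrt

/-! ## The generators and the field -/

/-- The three radicands `−1, λ, λ − 1 ∈ F_tpd` of the theta closure field. [claim: Mochizuki2012, status: disputed] -/
def thetaClosureRadicands : Set P.F := {-1, P.x, P.x - 1}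

/-- The square-root generators `{z ∈ F̄_tpd | z² ∈ {−1, λ, λ−1}}` (both signs).
[claim: Mochizuki2012, status: disputed] -/
def thetaClosureRoots : Set (AlgebraicClosure P.F) :=
  ⋃ a ∈ thetaClosureRadicands P, {z | z ^ 2 = algebraMap P.F _ a}

/-- The torsion generators: the coordinates of the `15`-torsion points of the Legendre curve `E_λ` over
`F̄_tpd` ("the fields of definition of the `(3·5)`-torsion points", p. 22). [claim: Mochizuki2012, status: disputed] -/
def thetaClosureTorsionCoords : Set (AlgebraicClosure P.F) :=
  ⋃ T ∈ {T : geomPoints P.legendreCurve | (15 : ℤ) • T = 0}, pointCoords T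

/-- The generating set of `F‡` over `F_tpd`: square roots of `−1, λ, λ−1` and the `15`-torsion coordinates.
[claim: Mochizuki2012, status: disputed] -/
def thetaClosureGens : Set (AlgebraicClosure P.F) := thetaClosureRoots P ∪ thetaClosureTorsionCoords P

/-- **The theta closure field `F‡ := F_tpd(√−1, √λ, √(λ−1), E_λ[3·5]) ⊆ F̄_tpd`** — the Galois closure over
`F_mod` of the field of [IUTchIV] Thm. 1.10, p. 22 (sequel file for the closure property).
[claim: Mochizuki2012, status: disputed] -/
def thetaClosureField : IntermediateField P.F (AlgebraicClosure P.F) := adjoin P.F (thetaClosureGens P)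

/-! ## Finiteness and Galois stability of the generators -/

/-- The root generators form a finite set. [claim: Mochizuki2012, status: disputed] -/
theorem thetaClosureRoots_finite : (thetaClosureRoots P).Finite := by
  refine Set.Finite.biUnion ?_ fun a _ => sqrtSet_finite a
  simp [thetaClosureRadicands]

/-- The torsion generators form a finite set (finitely many `15`-torsion points, two coordinates each).
[claim: Mochizuki2012, status: disputed] -/
theorem thetaClosureTorsionCoords_finite [hU : Fact P.InU] : (thetaClosureTorsionCoords P).Finite := by
  haveI : P.legendreCurve.IsElliptic := P.legendreCurve_isElliptic_iff.2 hU.out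
  have hTorfin : {T : geomPoints P.legendreCurve | (15 : ℤ) • T = 0}.Finite := by
    haveI := finite_torsionPoints_holds P.legendreCurve (AlgebraicClosure P.F) (n := (15 : ℤ)) (by norm_num)
    haveI : Finite {T : geomPoints P.legendreCurve | (15 : ℤ) • T = 0} := Finite.of_injective
      (fun T : {T : geomPoints P.legendreCurve | (15 : ℤ) • T = 0} =>
        (⟨(T.1 : (P.legendreCurve.baseChange (AlgebraicClosure P.F)).toAffine.Point),
          (mem_torsionPoints_iff (W := P.legendreCurve) (L := AlgebraicClosure P.F) _).2 T.2⟩ :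
          torsionPoints P.legendreCurve (AlgebraicClosure P.F) (15 : ℤ)))
      (fun a b h => Subtype.ext (show (a.1 : geomPoints P.legendreCurve) = b.1 from congrArg Subtype.val h))
    exact Set.toFinite _
  exact hTorfin.biUnion fun T _ => pointCoords_finite T

/-- The generating set is finite. [claim: Mochizuki2012, status: disputed] -/
theorem thetaClosureGens_finite [Fact P.InU] : (thetaClosureGens P).Finite :=
  (thetaClosureRoots_finite P).union (thetaClosureTorsionCoords_finite P)

/-- `15`-torsion is preserved by the Galois action (which is by group automorphisms). [cite: SilvermanAEC2009, VIII.§1] -/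
theorem smul_torsion_fifteen (τ : absoluteGaloisGroup P.F) {T : geomPoints P.legendreCurve}
    (hT : (15 : ℤ) • T = 0) : (15 : ℤ) • (τ • T) = 0 := by
  rw [smul_comm, hT, smul_zero]

/-- A coordinate of a `15`-torsion point is a torsion generator. [claim: Mochizuki2012, status: disputed] -/
theorem mem_thetaClosureTorsionCoords {T : geomPoints P.legendreCurve} (hT : (15 : ℤ) • T = 0)
    {z : AlgebraicClosure P.F} (hz : z ∈ pointCoords T) : z ∈ thetaClosureTorsionCoords P :=
  Set.mem_iUnion₂.2 ⟨T, hT, hz⟩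

/-- **The generating set is `Gal(F̄_tpd/F_tpd)`-stable** (square roots of elements of `F_tpd` go to square
roots; torsion points go to torsion points, Silverman *AEC* VIII.§1). [claim: Mochizuki2012, status: disputed] -/
theorem thetaClosureGens_stable (σ : AlgebraicClosure P.F ≃ₐ[P.F] AlgebraicClosure P.F)
    {s : AlgebraicClosure P.F} (hs : s ∈ thetaClosureGens P) : σ s ∈ thetaClosureGens P := by
  rcases hs with hs | hs
  · obtain ⟨a, ha, hz⟩ := Set.mem_iUnion₂.1 hs
    exact Or.inl (Set.mem_iUnion₂.2 ⟨a, ha, sq_eq_of_sq_eq σ hz⟩)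
  · obtain ⟨T, hT, hz⟩ := Set.mem_iUnion₂.1 hs
    set τ : absoluteGaloisGroup P.F := (absoluteGaloisGroup.toAlgEquiv P.F).symm σ with hτ
    have hστ : σ s = τ • s := (absoluteGaloisGroup.toAlgEquiv_symm_apply σ s).symm
    rw [hστ]
    refine Or.inr (mem_thetaClosureTorsionCoords P (smul_torsion_fifteen P τ hT) ?_)
    rw [pointCoords_smul]
    exact ⟨s, hz, rfl⟩

/-! ## `F‡` is a number field, Galois over `F_tpd`, of degree dividing `2²·46080` -/

/-- `F‡/F_tpd` is finite-dimensional (finitely many algebraic generators). [claim: Mochizuki2012, status: disputed] -/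
instance finiteDimensional_thetaClosureField [Fact P.InU] : FiniteDimensional P.F (thetaClosureField P) := by
  haveI : Finite (thetaClosureGens P) := (thetaClosureGens_finite P).to_subtype
  exact finiteDimensional_adjoin fun x _ => Algebra.IsIntegral.isIntegral x

/-- `F‡` is a number field. [claim: Mochizuki2012, status: disputed] -/
instance numberField_thetaClosureField [Fact P.InU] : NumberField (thetaClosureField P) :=
  NumberField.of_module_finite P.F (thetaClosureField P)

/-- **`F‡/F_tpd` is Galois** (adjunction of a finite Galois-stable set). [claim: Mochizuki2012, status: disputed] -/
instance isGalois_thetaClosureField [Fact P.InU] : IsGalois P.F (thetaClosureField P) :=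
  isGalois_adjoin_of_stable fun σ _ hs => thetaClosureGens_stable P σ hs

/-- The generators lie in `F‡`. [claim: Mochizuki2012, status: disputed] -/
theorem mem_thetaClosureField_of_mem_gens {z : AlgebraicClosure P.F} (hz : z ∈ thetaClosureGens P) :
    z ∈ thetaClosureField P :=
  subset_adjoin P.F _ hz

/-- **Every square root of `−1`, `λ`, `λ − 1` lies in `F‡`.** [claim: Mochizuki2012, status: disputed] -/
theorem sqrt_mem_thetaClosureField {a : P.F} (ha : a ∈ thetaClosureRadicands P) {z : AlgebraicClosure P.F}
    (hz : z ^ 2 = algebraMap P.F _ a) : z ∈ thetaClosureField P :=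
  mem_thetaClosureField_of_mem_gens P (Or.inl (Set.mem_iUnion₂.2 ⟨a, ha, hz⟩))

/-- **The coordinates of every `15`-torsion point of `E_λ(F̄_tpd)` lie in `F‡`.** [claim: Mochizuki2012, status: disputed] -/
theorem coords_mem_thetaClosureField {T : geomPoints P.legendreCurve} (hT : (15 : ℤ) • T = 0)
    {z : AlgebraicClosure P.F} (hz : z ∈ pointCoords T) : z ∈ thetaClosureField P :=
  mem_thetaClosureField_of_mem_gens P (Or.inr (mem_thetaClosureTorsionCoords P hT hz))

/-- **`√−1 ∈ F‡`** ([IUTchI] Def. 3.1 (a)). [claim: Mochizuki2012, status: disputed] -/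
theorem exists_sq_eq_neg_one_thetaClosureField : ∃ i : thetaClosureField P, i ^ 2 = -1 := by
  obtain ⟨i, hi⟩ : ∃ i : AlgebraicClosure P.F, i ^ 2 = -1 := IsAlgClosed.exists_pow_nat_eq _ two_pos
  have hi' : i ^ 2 = algebraMap P.F (AlgebraicClosure P.F) (-1) := by rw [hi, map_neg, map_one]
  refine ⟨⟨i, sqrt_mem_thetaClosureField P (by simp [thetaClosureRadicands]) hi'⟩, Subtype.ext ?_⟩
  simp [hi]

/-- **`√λ ∈ F‡`**. [claim: Mochizuki2012, status: disputed] -/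
theorem exists_sq_eq_lambda_thetaClosureField :
    ∃ w : thetaClosureField P, w ^ 2 = algebraMap P.F (thetaClosureField P) P.x := by
  obtain ⟨w, hw⟩ : ∃ w : AlgebraicClosure P.F, w ^ 2 = algebraMap P.F _ P.x :=
    IsAlgClosed.exists_pow_nat_eq _ two_pos
  exact ⟨⟨w, sqrt_mem_thetaClosureField P (by simp [thetaClosureRadicands]) hw⟩, Subtype.ext (by simpa using hw)⟩

/-- **`√(λ − 1) ∈ F‡`**. [claim: Mochizuki2012, status: disputed] -/
theorem exists_sq_eq_lambda_sub_one_thetaClosureField :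
    ∃ w : thetaClosureField P, w ^ 2 = algebraMap P.F (thetaClosureField P) (P.x - 1) := by
  obtain ⟨w, hw⟩ : ∃ w : AlgebraicClosure P.F, w ^ 2 = algebraMap P.F _ (P.x - 1) :=
    IsAlgClosed.exists_pow_nat_eq _ two_pos
  exact ⟨⟨w, sqrt_mem_thetaClosureField P (by simp [thetaClosureRadicands]) hw⟩, Subtype.ext (by simpa using hw)⟩

/-- The fixing group of `F_tpd(all square roots of a)`. [cite: MilneFT2022, Ch. 5 (Kummer theory: the polynomial X² − a)] -/
abbrev sqrtFixer (a : P.F) : Subgroup (absoluteGaloisGroup P.F) :=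
  (adjoin P.F {z : AlgebraicClosure P.F | z ^ 2 = algebraMap P.F _ a}).fixingSubgroup

/-- The subgroup of `Gal(F̄_tpd/F_tpd)` fixing `E_λ[3]`, `E_λ[5]` and the square roots of `−1`, `λ`, `λ−1`
fixes every generator (a `15`-torsion point is `10T − 9T`). [claim: Mochizuki2012, status: disputed] -/
theorem gens_fixed_of_mem (τ : absoluteGaloisGroup P.F)
    (h3 : τ ∈ (P.legendreCurve.galoisRepTorsion ((3 : ℕ) : ℤ)).ker)
    (h5 : τ ∈ (P.legendreCurve.galoisRepTorsion ((5 : ℕ) : ℤ)).ker)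
    (hτi : τ ∈ sqrtFixer P (-1)) (hτl : τ ∈ sqrtFixer P P.x) (hτm : τ ∈ sqrtFixer P (P.x - 1))
    {s : AlgebraicClosure P.F} (hs : s ∈ thetaClosureGens P) : τ • s = s := by
  rcases hs with hs | hs
  · obtain ⟨a, ha, hz⟩ := Set.mem_iUnion₂.1 hs
    simp only [thetaClosureRadicands, Set.mem_insert_iff, Set.mem_singleton_iff] at ha
    rcases ha with rfl | rfl | rfl
    · exact forall_eq_of_mem_fixingSubgroup_adjoin hτi s hz
    · exact forall_eq_of_mem_fixingSubgroup_adjoin hτl s hz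
    · exact forall_eq_of_mem_fixingSubgroup_adjoin hτm s hz
  · obtain ⟨T, hT, hz⟩ := Set.mem_iUnion₂.1 hs
    have h3' : ∀ Q : geomTorsion P.legendreCurve ((3 : ℕ) : ℤ), τ • Q = Q := by
      intro Q
      have hQ := galoisRepTorsion_apply P.legendreCurve ((3 : ℕ) : ℤ) τ Q
      rw [(MonoidHom.mem_ker).1 h3] at hQ
      exact hQ.symm
    have h5' : ∀ Q : geomTorsion P.legendreCurve ((5 : ℕ) : ℤ), τ • Q = Q := by
      intro Q
      have hQ := galoisRepTorsion_apply P.legendreCurve ((5 : ℕ) : ℤ) τ Q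
      rw [(MonoidHom.mem_ker).1 h5] at hQ
      exact hQ.symm
    exact forall_coords_of_smul_eq P τ T (smul_eq_of_fifteen τ h3' h5' T hT) s hz

/-- **`[F‡ : F_tpd] ∣ 2²·46080 = 2¹²·3²·5`** (`Gal ↪ ℤ/2 × ℤ/2 × ℤ/2 × GL₂(𝔽₃) × GL₂(𝔽₅)`: Krull index of
`ker ρ̄₃ ∩ ker ρ̄₅ ∩` the three quadratic fixers; [IUTchIV] Thm. 1.10 Step (ii) p. 24 — print's `Gal(F/F_tpd) ↪
GL₂(𝔽₃) × GL₂(𝔽₅) × ℤ/2ℤ`, `46080` — with two extra quadratic layers). [claim: Mochizuki2012, status: disputed] -/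
theorem finrank_thetaClosureField_dvd (hU : P.InU) :
    Module.finrank P.F (thetaClosureField P) ∣ 2 ^ 2 * 46080 := by
  haveI : P.legendreCurve.IsElliptic := P.legendreCurve_isElliptic_iff.2 hU
  haveI : Fact (Nat.Prime 3) := ⟨Nat.prime_three⟩
  haveI : Fact (Nat.Prime 5) := ⟨Nat.prime_five⟩
  set K3 : Subgroup (absoluteGaloisGroup P.F) := (P.legendreCurve.galoisRepTorsion ((3 : ℕ) : ℤ)).ker
  set K5 : Subgroup (absoluteGaloisGroup P.F) := (P.legendreCurve.galoisRepTorsion ((5 : ℕ) : ℤ)).ker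
  haveI : K3.Normal := MonoidHom.normal_ker _
  haveI : K5.Normal := MonoidHom.normal_ker _
  haveI hi : IsGalois P.F (adjoin P.F {z : AlgebraicClosure P.F | z ^ 2 = algebraMap P.F _ (-1)}) :=
    isGalois_adjoin_sqrtSet _
  haveI hl : IsGalois P.F (adjoin P.F {z : AlgebraicClosure P.F | z ^ 2 = algebraMap P.F _ P.x}) :=
    isGalois_adjoin_sqrtSet _
  haveI hm : IsGalois P.F (adjoin P.F {z : AlgebraicClosure P.F | z ^ 2 = algebraMap P.F _ (P.x - 1)}) :=
    isGalois_adjoin_sqrtSet _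
  haveI : (sqrtFixer P (-1)).Normal := IsGalois.fixingSubgroup_normal_of_isGalois _
  haveI : (sqrtFixer P P.x).Normal := IsGalois.fixingSubgroup_normal_of_isGalois _
  haveI : (sqrtFixer P (P.x - 1)).Normal := IsGalois.fixingSubgroup_normal_of_isGalois _
  set H : Subgroup (absoluteGaloisGroup P.F) :=
    K3 ⊓ K5 ⊓ sqrtFixer P (-1) ⊓ sqrtFixer P P.x ⊓ sqrtFixer P (P.x - 1) with hHdef
  have hHfix : ∀ τ ∈ H, ∀ s ∈ thetaClosureGens P, τ • s = s := fun τ hτ s hs =>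
    gens_fixed_of_mem P τ hτ.1.1.1.1 hτ.1.1.1.2 hτ.1.1.2 hτ.1.2 hτ.2 hs
  have hdvd : Module.finrank P.F (thetaClosureField P) ∣ H.index := finrank_adjoin_dvd_index H hHfix
  refine hdvd.trans ?_
  have e35 : (K3 ⊓ K5).index ∣ (3 * (3 - 1) ^ 2 * (3 + 1)) * (5 * (5 - 1) ^ 2 * (5 + 1)) :=
    (index_inf_dvd_mul_of_normal _ _).trans (Nat.mul_dvd_mul
      (P.legendreCurve.index_ker_galoisRepTorsion_dvd 3) (P.legendreCurve.index_ker_galoisRepTorsion_dvd 5))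
  have e1 : (K3 ⊓ K5 ⊓ sqrtFixer P (-1)).index ∣
      ((3 * (3 - 1) ^ 2 * (3 + 1)) * (5 * (5 - 1) ^ 2 * (5 + 1))) * 2 :=
    (index_inf_dvd_mul_of_normal _ _).trans
      (Nat.mul_dvd_mul e35 (index_fixingSubgroup_adjoin_sqrtSet_dvd_two _))
  have e2 : (K3 ⊓ K5 ⊓ sqrtFixer P (-1) ⊓ sqrtFixer P P.x).index ∣
      ((3 * (3 - 1) ^ 2 * (3 + 1)) * (5 * (5 - 1) ^ 2 * (5 + 1))) * 2 * 2 :=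
    (index_inf_dvd_mul_of_normal _ _).trans
      (Nat.mul_dvd_mul e1 (index_fixingSubgroup_adjoin_sqrtSet_dvd_two _))
  have e3 : H.index ∣ ((3 * (3 - 1) ^ 2 * (3 + 1)) * (5 * (5 - 1) ^ 2 * (5 + 1))) * 2 * 2 * 2 :=
    (index_inf_dvd_mul_of_normal _ _).trans
      (Nat.mul_dvd_mul e2 (index_fixingSubgroup_adjoin_sqrtSet_dvd_two _))
  have : ((3 * (3 - 1) ^ 2 * (3 + 1)) * (5 * (5 - 1) ^ 2 * (5 + 1))) * 2 * 2 * 2 = 2 ^ 2 * 46080 := by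
    norm_num
  rw [← this]
  exact e3

/-- **`[F‡ : F_tpd]` is prime to every prime `l ≥ 7`** ([IUTchI] Def. 3.1 (b) "degree prime to `l`", over
`F_tpd`; over `F_mod` one more factor `[F_tpd : F_mod] ≤ 6` enters, sequel file). [claim: Mochizuki2012, status: disputed] -/
theorem finrank_thetaClosureField_coprime (hU : P.InU) {l : ℕ} (hl : l.Prime) (h7 : 7 ≤ l) :
    (Module.finrank P.F (thetaClosureField P)).Coprime l := by
  have h := finrank_thetaClosureField_dvd P hU
  have hfac : 2 ^ 2 * 46080 = 2 ^ 12 * 3 ^ 2 * 5 := by norm_num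
  rw [hfac] at h
  apply Nat.Coprime.coprime_dvd_left h
  have h2 : Nat.Coprime 2 l := (Nat.coprime_primes Nat.prime_two hl).2 (by omega)
  have h3 : Nat.Coprime 3 l := (Nat.coprime_primes Nat.prime_three hl).2 (by omega)
  have h5 : Nat.Coprime 5 l := (Nat.coprime_primes Nat.prime_five hl).2 (by omega)
  exact Nat.Coprime.mul_left (Nat.Coprime.mul_left (h2.pow_left 12) (h3.pow_left 2)) h5

/-! ## The torsion of `E_λ ⊗ F‡` over the algebraic closure of `F‡` -/

/-- The fixing group of `F‡` acts trivially on `E_λ[n]` for `n ∣ 15` (its elements fix the coordinates of the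
`15`-torsion points, hence the points, hence `E[n] ⊆ E[15]`). [claim: Mochizuki2012, status: disputed] -/
theorem fixingSubgroup_le_ker {n : ℕ} (hn : (n : ℤ) ∣ 15) :
    (thetaClosureField P).fixingSubgroup ≤ (P.legendreCurve.galoisRepTorsion (n : ℤ)).ker := by
  intro σ hσ
  obtain ⟨m, hm⟩ := hn
  have key := (Set.ext_iff.1 (coe_ker_galoisRepTorsion P.legendreCurve (n : ℤ)) σ).2
  refine key (Set.mem_iInter.2 fun Q => ?_)
  rw [SetLike.mem_coe, MulAction.mem_stabilizer_iff]
  have hQ : (n : ℤ) • (Q : geomPoints P.legendreCurve) = 0 :=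
    (Submodule.mem_torsionBy_iff (n : ℤ) (Q : geomPoints P.legendreCurve)).mp Q.2
  have hQ15 : (15 : ℤ) • (Q : geomPoints P.legendreCurve) = 0 := by
    rw [hm, mul_comm, mul_smul, hQ, smul_zero]
  refine smul_eq_of_forall_coords P σ Q ?_
  intro z hz
  exact forall_eq_of_mem_fixingSubgroup_adjoin hσ z (Or.inr (mem_thetaClosureTorsionCoords P hQ15 hz))

/-- **`E_λ[3]` is rational over `F‡`**: every geometric `3`-torsion point of `E_λ ⊗ F‡` (over the algebraic
closure OF `F‡`) is fixed by `Gal(F̄‡/F‡)`. [claim: Mochizuki2012, status: disputed] -/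
theorem torsion_three_fixed [Fact P.InU] (hU : P.InU) :
    ∀ (σ : absoluteGaloisGroup (thetaClosureField P))
      (Q : (P.legendreCurve.map (algebraMap P.F (thetaClosureField P))).geomTorsion ((3 : ℕ) : ℤ)),
      σ • Q = Q :=
  @EllPoint.forall_smul_geomTorsion_map_eq_of_fixingSubgroup_le (P.legendre hU) (thetaClosureField P)
    (numberField_thetaClosureField P) 3 (fixingSubgroup_le_ker P ⟨5, by norm_num⟩)

/-- **`E_λ[5]` is rational over `F‡`**. [claim: Mochizuki2012, status: disputed] -/
theorem torsion_five_fixed [Fact P.InU] (hU : P.InU) :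
    ∀ (σ : absoluteGaloisGroup (thetaClosureField P))
      (Q : (P.legendreCurve.map (algebraMap P.F (thetaClosureField P))).geomTorsion ((5 : ℕ) : ℤ)),
      σ • Q = Q :=
  @EllPoint.forall_smul_geomTorsion_map_eq_of_fixingSubgroup_le (P.legendre hU) (thetaClosureField P)
    (numberField_thetaClosureField P) 5 (fixingSubgroup_le_ker P ⟨3, by norm_num⟩)

/-- The Legendre curve over `F‡` is the base change of `E_λ`. [claim: Mochizuki2012, status: disputed] -/
theorem thetaCurve_thetaClosureField_eq [Fact P.InU] :
    thetaCurve P (thetaClosureField P) = P.legendreCurve.map (algebraMap P.F (thetaClosureField P)) :=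
  thetaCurve_eq_map P _

/-- **The `15`-torsion of `E_λ ⊗ F‡` is rational over `F‡`** ("the `(3·5)`-torsion points of `E_F` are
defined over `F`", p. 22), in the shape of `IsThetaField.torsion_rational`. [claim: Mochizuki2012, status: disputed] -/
theorem torsion_fifteen_fixed [Fact P.InU] (hU : P.InU) :
    ∀ σ : absoluteGaloisGroup (thetaClosureField P),
      ∀ T : geomPoints (thetaCurve P (thetaClosureField P)), (15 : ℤ) • T = 0 → σ • T = T := by
  rw [thetaCurve_thetaClosureField_eq]
  intro σ T hT
  exact smul_eq_of_fifteen σ (torsion_three_fixed P hU σ) (torsion_five_fixed P hU σ) T hT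

/-- **`E_λ ⊗ F‡` is semistable** (its `15`-torsion is rational: [IUTchIV] Prop. 1.8 (v) = Raynaud's criterion in
the tree, `p = 3`, `q = 5`). [claim: Mochizuki2012, status: disputed] -/
theorem isSemistable_thetaCurve_thetaClosureField [Fact P.InU] (hU : P.InU) :
    (thetaCurve P (thetaClosureField P)).IsSemistable (𝓞 (thetaClosureField P)) := by
  rw [thetaCurve_thetaClosureField_eq]
  haveI : (P.legendreCurve.map (algebraMap P.F (thetaClosureField P))).IsElliptic := by
    rw [← thetaCurve_thetaClosureField_eq]; exact thetaCurve_isElliptic hU _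
  exact (P.legendreCurve.map (algebraMap P.F (thetaClosureField P))).isSemistable_of_forall_smul_geomTorsion_eq_of_ne
    Nat.prime_three Nat.prime_five le_rfl (by norm_num) (by norm_num) (torsion_three_fixed P hU)
    (torsion_five_fixed P hU)

end Cor22

end Literature.IUT.LogVolume

end
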